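import Mathlib
import Literature.Computability.AlgebraicComplexity.WordPolynomialRank
import Literature.Computability.AlgebraicComplexity.IMMInVPProofs
import Literature.Computability.AlgebraicComplexity.ArithCircuitProofs
import Literature.Barriers.ValiantsHypothesis.AlgebraicNaturalProofs

/-!
# Route BarrierLever — crux `DefinableEquations` (stmt-8745) / item `SingleSizeEquations`
# (stmt-8749): a METHOD WALL — the LIMAYE–SRINIVASAN–TAVENAS relative-rank certificates are
# SATURATED BY A POLYNOMIAL OF COMPLEXITY `≤ 4n⁴` at EVERY word parameter (val-np-p5 g10)

g8 made the strongest constant-depth lower-bound method FSV-natural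
(`…ProductDepthSlice.lean`): for word blocks `X(w_1), …, X(w_d)` embedded by `e` among
`x_1, …, x_n`, the class condition of the method is the rank bound
`pdRank (killCompl e f) < 2^{min(|σ⁺|,|σ⁻|)}` on the block coefficient matrix of `f`, which the
LST engine supplies for every `f` with a product-depth-`Δ` circuit of size `n^b` once
`Λ_Δ(n^b, n, d) Φ_Δ(k, d) < 2^{-k/2}`; the natural proof is a coordinate determinant
(`BlockPlacement.not_isSuccinctHittingSet_of_pdRank_lt`).  This file records the WALL of the
method against GENERAL (unbounded product-depth) circuits, uniformly in ALL word parameters: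

**Theorem (`exists_fullPdRank_complexity_le`).**  For every `n`, every word datum `(k, pos, d)`
with `1 ≤ d ≤ n` and `2^{|w_{[t]}|} ≤ n` for all `t ≤ d` (the side condition of the tree's
`wordSubst`), and every embedding `e` of the block variables into `x_1..x_n`, the polynomial
`f = e_*(P_w)` — LST's WORD POLYNOMIAL placed on the embedded blocks — has degree `≤ n`,
complexity `≤ n + 3n⁴ ≤ 4n⁴` (it is a linear projection of `IMM_{n,d}`, tree
`aeval_wordSubst_immPoly` + `complexity_immPoly_le` + `complexity_aeval_le`), and FULL block rank
`pdRank (killCompl e f) = 2^{min(|σ⁺|,|σ⁻|)}` (tree `pdRank_wordPoly`, `killCompl_rename_app`).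

**Corollaries (the wall).**  `exists_fullPdRank_smallCircuits`: such an `f` lies in
`SmallCircuits ℂ n 5` (`n ≥ 4`); `not_forall_pdRank_lt_smallCircuits`: the method's class condition
FAILS on `SmallCircuits ℂ n 5` for every word parameter; `not_relRank_lt_smallCircuits`: so does
the engine inequality `relRank < 2^{-k/2}` (for `|w_{[d]}| ≤ k`); `not_isNaturalProof_of_zeroSet_pdRankLt`:
a `D` in the coefficient variables whose zero set on degree-`≤ n` coefficient vectors is the
rank-deficient locus `{pdRank < 2^{min}}` is not an `IsNaturalProof` against `SmallCircuits ℂ n 5`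
in ANY distinguisher class (any level, Boolean sums included).

Chart line: LST's method — natural proofs against every constant product-depth at every
polynomial size (g8, level one uniformly by g9); WALL at general size `4n⁴ ≤ n⁵` for all its
parameters (this file: the word polynomial is a projection of `IMM`, which has small circuits
of unbounded depth).  What this is NOT: nothing on other methods, on the crux (b = 2 OPEN,
Chatterjee–Tengse §1.3 dir. 2) or on `VP ≠ VNP`.  No definitions, no named facts, standard axioms.
Refs: Limaye–Srinivasan–Tavenas, J. ACM 72 (2025) Art. 26, §2.2, Lemma 8, Lemma 22;
Kumar–Saraf 2017 §3 (`IMM ∈ VP`); Forbes–Shpilka–Volk 2018 Def. 1/3.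
-/

-- `Summit.ValiantsHypothesis.ValiantsHypothesis.…` repeats a component by the D-0017 layout
-- (single-conjunct summit), which the `dupNamespace` linter flags; the name is mandated.
set_option linter.dupNamespace false

noncomputable section

namespace Summit.ValiantsHypothesis.ValiantsHypothesis.Theorems.BarrierLeverDefinableEquations

open MvPolynomial
open Literature.Computability.AlgebraicComplexity
open Literature.Computability.AlgebraicComplexity.LSTWord
open Literature.Barriers.ValiantsHypothesis
open scoped BigOperators

namespace ProductDepthWall

variable {d : ℕ} (k : ℕ) (pos : Fin d → Bool)

/-! ## §1 The word polynomial: degree and complexity -/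

/-- `deg P_w ≤ d`: every monomial of the word polynomial picks one variable per block.
[cite: LimayeSrinivasanTavenas2025, §2.2] -/
theorem totalDegree_wordPoly_le : (wordPoly k pos ℂ).totalDegree ≤ d := by
  classical
  unfold wordPoly
  refine (totalDegree_finsetSum _ _).trans (Finset.sup_le fun w _ => ?_)
  split_ifs
  · refine (totalDegree_finsetProd _ _).trans ?_
    calc ∑ i : Fin d, (X ⟨i, w i⟩ : MvPolynomial (Σ i : Fin d, BlockVar k pos i) ℂ).totalDegree
        ≤ ∑ _i : Fin d, 1 := Finset.sum_le_sum fun i _ => by rw [totalDegree_X]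
      _ = d := by simp
  · simp

/-- The substitution `ρ` of LST's Lemma 8 sends each `IMM` variable to a `0/1`-combination of the
variables of one block, of complexity at most the size of that block.
[cite: LimayeSrinivasanTavenas2025, Lemma 8] -/
theorem complexity_wordSubst_le {n : ℕ} (hn : ∀ t ≤ d, 2 ^ overLen k pos t ≤ n)
    (v : Fin d × Fin n × Fin n) :
    complexity (wordSubst k pos ℂ hn v) ≤ Fintype.card (BlockVar k pos v.1) := by
  classical
  unfold wordSubst LayeredAutomaton.autSubst
  refine (complexity_finset_sum_le _ _).trans ?_
  have h0 : ∀ (P : Prop) [Decidable P] (x : Σ i : Fin d, BlockVar k pos i),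
      complexity (if P then (X x : MvPolynomial (Σ i : Fin d, BlockVar k pos i) ℂ) else 0) = 0 := by
    intro P _ x
    split_ifs
    · exact complexity_X_holds (k := ℂ) _
    · simpa using complexity_C_holds (σ := (Σ i : Fin d, BlockVar k pos i)) (0 : ℂ)
  simp only [h0, Finset.sum_const_zero, zero_add, Finset.card_univ, le_refl]

/-- If the block variables embed into `x_1..x_n`, every block has at most `n` variables. [folklore] -/
theorem card_blockVar_le {n : ℕ} (e : (Σ i : Fin d, BlockVar k pos i) ↪ Fin n) (i : Fin d) :
    Fintype.card (BlockVar k pos i) ≤ n := by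
  classical
  have h := Fintype.card_le_of_embedding ((Function.Embedding.sigmaMk i).trans e)
  rwa [Fintype.card_fin] at h

/-- **Complexity of the word polynomial**: `L(P_w) ≤ n + 2n³d + d·n²·n` when the blocks embed
into `n` variables and the automaton states into `Fin n` — a projection of `IMM_{n,d}`
(`L(IMM_{n,d}) ≤ n + 2n³d`, Kumar–Saraf) by `d n²` substitutions of cost `≤ n` each.
[cite: LimayeSrinivasanTavenas2025, Lemma 8] [cite: KumarSaraf2017, §3] -/
theorem complexity_wordPoly_le {n : ℕ} (hd : 1 ≤ d) (hn : ∀ t ≤ d, 2 ^ overLen k pos t ≤ n)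
    (e : (Σ i : Fin d, BlockVar k pos i) ↪ Fin n) :
    complexity (wordPoly k pos ℂ) ≤ n + 2 * n ^ 3 * d + d * n ^ 2 * n := by
  classical
  rw [← aeval_wordSubst_immPoly k pos ℂ hn (by omega)]
  refine (complexity_aeval_le _ _).trans ?_
  refine Nat.add_le_add (complexity_immPoly_le ℂ n d) ?_
  calc ∑ v : Fin d × Fin n × Fin n, complexity (wordSubst k pos ℂ hn v)
      ≤ ∑ v : Fin d × Fin n × Fin n, n :=
        Finset.sum_le_sum fun v _ => (complexity_wordSubst_le k pos hn v).trans
          (card_blockVar_le k pos e v.1)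
    _ = d * n ^ 2 * n := by
        simp only [Finset.sum_const, Finset.card_univ, smul_eq_mul, Fintype.card_prod,
          Fintype.card_fin]
        ring

/-! ## §2 The placed word polynomial `e_*(P_w) ∈ ℂ[x_1, …, x_n]` -/

/-- **The saturating polynomial**: for every word datum and every embedding `e` of its blocks,
`f = e_*(P_w)` has degree `≤ n` (given `d ≤ n`), complexity `≤ n + 3n⁴`, and FULL block rank
`pdRank (killCompl e f) = 2^{min(|σ⁺|, |σ⁻|)}` — the value the LST condition forbids.
[cite: LimayeSrinivasanTavenas2025, §2.2 and Lemma 8] -/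
theorem exists_fullPdRank_complexity_le {n : ℕ} (hd : 1 ≤ d) (hdn : d ≤ n)
    (hn : ∀ t ≤ d, 2 ^ overLen k pos t ≤ n) (e : (Σ i : Fin d, BlockVar k pos i) ↪ Fin n) :
    ∃ f : MvPolynomial (Fin n) ℂ, f.totalDegree ≤ n ∧ complexity f ≤ n + 3 * n ^ 4 ∧
      pdRank ℂ (posBlocks pos) (negBlocks pos) (killCompl e.injective f) =
        2 ^ min (streamLen k pos true d) (streamLen k pos false d) := by
  classical
  refine ⟨rename e (wordPoly k pos ℂ), ?_, ?_, ?_⟩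
  · exact (totalDegree_rename_le _ _).trans ((totalDegree_wordPoly_le k pos).trans hdn)
  · refine (complexity_rename_le_holds' (k := ℂ) e _).trans ?_
    refine (complexity_wordPoly_le k pos hd hn e).trans ?_
    have h1 : 2 * n ^ 3 * d ≤ 2 * n ^ 4 := by
      calc 2 * n ^ 3 * d ≤ 2 * n ^ 3 * n := Nat.mul_le_mul_left _ hdn
        _ = 2 * n ^ 4 := by ring
    have h2 : d * n ^ 2 * n ≤ n ^ 4 := by
      calc d * n ^ 2 * n ≤ n * n ^ 2 * n := by gcongr
        _ = n ^ 4 := by ring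
    omega
  · rw [killCompl_rename_app]
    exact pdRank_wordPoly k pos ℂ

/-- Hence a member of `SmallCircuits ℂ n 5` of FULL block rank, for `n ≥ 4` (`n + 3n⁴ ≤ n⁵`),
every word datum and every embedding. [cite: ForbesShpilkaVolk2018, Cor. 5] -/
theorem exists_fullPdRank_smallCircuits {n : ℕ} (h4 : 4 ≤ n) (hd : 1 ≤ d) (hdn : d ≤ n)
    (hn : ∀ t ≤ d, 2 ^ overLen k pos t ≤ n) (e : (Σ i : Fin d, BlockVar k pos i) ↪ Fin n) :
    ∃ f ∈ SmallCircuits ℂ n 5,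
      pdRank ℂ (posBlocks pos) (negBlocks pos) (killCompl e.injective f) =
        2 ^ min (streamLen k pos true d) (streamLen k pos false d) := by
  obtain ⟨f, hdeg, hL, hrk⟩ := exists_fullPdRank_complexity_le k pos hd hdn hn e
  refine ⟨f, ⟨hdeg, hL.trans ?_⟩, hrk⟩
  have : n + 3 * n ^ 4 ≤ 4 * n ^ 4 := by nlinarith [Nat.one_le_pow 3 n (by omega)]
  calc n + 3 * n ^ 4 ≤ 4 * n ^ 4 := this
    _ ≤ n * n ^ 4 := Nat.mul_le_mul_right _ h4
    _ = n ^ 5 := by ring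

/-! ## §3 The wall -/

/-- **The LST class condition fails on `SmallCircuits ℂ n 5`**: for NO word datum (any `k`, sign
pattern, `1 ≤ d ≤ n`, states fitting into `Fin n`) and no embedding does
`pdRank (killCompl e f) < 2^{min(|σ⁺|,|σ⁻|)}` hold for all `f ∈ SmallCircuits ℂ n 5` (`n ≥ 4`) —
the hypothesis `hrank` of `BlockPlacement.not_isSuccinctHittingSet_of_pdRank_lt` at full size.
[cite: LimayeSrinivasanTavenas2025, §2.2] -/
theorem not_forall_pdRank_lt_smallCircuits {n : ℕ} (h4 : 4 ≤ n) (hd : 1 ≤ d) (hdn : d ≤ n)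
    (hn : ∀ t ≤ d, 2 ^ overLen k pos t ≤ n) (e : (Σ i : Fin d, BlockVar k pos i) ↪ Fin n) :
    ¬ ∀ f ∈ SmallCircuits ℂ n 5,
      pdRank ℂ (posBlocks pos) (negBlocks pos) (killCompl e.injective f) <
        2 ^ min (streamLen k pos true d) (streamLen k pos false d) := by
  intro h
  obtain ⟨f, hf, hrk⟩ := exists_fullPdRank_smallCircuits k pos h4 hd hdn hn e
  exact absurd (h f hf) (by rw [hrk]; exact lt_irrefl _)

/-- **The engine inequality fails too**: with `|w_{[d]}| ≤ k` (the unbiasedness used by the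
slice), the placed word polynomial has `relRank = 2^{-|w_{[d]}|/2} ≥ 2^{-k/2}`, so
`relRank (killCompl e f) < 2^{-k/2}` does not hold on `SmallCircuits ℂ n 5`.
[cite: LimayeSrinivasanTavenas2025, §2.2 (`relrk_w(P_w)`)] -/
theorem not_relRank_lt_smallCircuits {n : ℕ} (h4 : 4 ≤ n) (hd : 1 ≤ d) (hdn : d ≤ n)
    (hn : ∀ t ≤ d, 2 ^ overLen k pos t ≤ n) (hover : overLen k pos d ≤ k)
    (e : (Σ i : Fin d, BlockVar k pos i) ↪ Fin n) :
    ¬ ∀ f ∈ SmallCircuits ℂ n 5,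
      relRank ℂ pos Finset.univ (killCompl e.injective f) < (2 : ℝ) ^ (-(k : ℝ) / 2) := by
  classical
  intro h
  obtain ⟨f, hdeg, hL, -⟩ := exists_fullPdRank_complexity_le k pos hd hdn hn e
  -- the witness of the previous theorems is `rename e P_w`; rebuild it to read off `relRank`
  have hmem : rename e (wordPoly k pos ℂ) ∈ SmallCircuits ℂ n 5 := by
    refine ⟨(totalDegree_rename_le _ _).trans ((totalDegree_wordPoly_le k pos).trans hdn), ?_⟩
    refine (complexity_rename_le_holds' (k := ℂ) e _).trans ?_
    refine (complexity_wordPoly_le k pos hd hn e).trans ?_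
    have h1 : 2 * n ^ 3 * d ≤ 2 * n ^ 4 := by
      calc 2 * n ^ 3 * d ≤ 2 * n ^ 3 * n := Nat.mul_le_mul_left _ hdn
        _ = 2 * n ^ 4 := by ring
    have h2 : d * n ^ 2 * n ≤ n ^ 4 := by
      calc d * n ^ 2 * n ≤ n * n ^ 2 * n := by gcongr
        _ = n ^ 4 := by ring
    have h3 : n + 3 * n ^ 4 ≤ 4 * n ^ 4 := by nlinarith [Nat.one_le_pow 3 n (by omega)]
    calc n + 2 * n ^ 3 * d + d * n ^ 2 * n ≤ 4 * n ^ 4 := by omega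
      _ ≤ n * n ^ 4 := Nat.mul_le_mul_right _ h4
      _ = n ^ 5 := by ring
  have hlt := h _ hmem
  rw [killCompl_rename_app, relRank_wordPoly] at hlt
  have hge : (2 : ℝ) ^ (-(k : ℝ) / 2) ≤ (2 : ℝ) ^ (-(overLen k pos d : ℝ) / 2) := by
    refine Real.rpow_le_rpow_of_exponent_le (by norm_num) ?_
    have : (overLen k pos d : ℝ) ≤ k := by exact_mod_cast hover
    linarith
  exact absurd (lt_of_le_of_lt hge hlt) (lt_irrefl _)

/-- **FSV form.**  A polynomial `D` in the `N = binom(2n,n)` coefficient variables whose zero set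
on degree-`≤ n` coefficient vectors is the LST rank-deficient locus
`{f : pdRank (killCompl e f) < 2^{min(|σ⁺|,|σ⁻|)}}` (for some word datum and embedding) is NOT an
`IsNaturalProof` against `SmallCircuits ℂ n 5` (`n ≥ 4`), whatever the distinguisher class `𝒟`.
[cite: ForbesShpilkaVolk2018, Def. 1] -/
theorem not_isNaturalProof_of_zeroSet_pdRankLt {n : ℕ} (h4 : 4 ≤ n) (hd : 1 ≤ d) (hdn : d ≤ n)
    (hn : ∀ t ≤ d, 2 ^ overLen k pos t ≤ n) (e : (Σ i : Fin d, BlockVar k pos i) ↪ Fin n)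
    (𝒟 : Set (MvPolynomial (degLEMonomials n) ℂ)) (D : MvPolynomial (degLEMonomials n) ℂ)
    (hD : ∀ g : MvPolynomial (Fin n) ℂ, g.totalDegree ≤ n →
      (eval (coeffVector (degLEMonomials n) g) D = 0 ↔
        pdRank ℂ (posBlocks pos) (negBlocks pos) (killCompl e.injective g) <
          2 ^ min (streamLen k pos true d) (streamLen k pos false d))) :
    ¬ IsNaturalProof (degLEMonomials n) (SmallCircuits ℂ n 5) 𝒟 D := by
  rintro ⟨-, -, hvan⟩
  obtain ⟨f, hf, hrk⟩ := exists_fullPdRank_smallCircuits k pos h4 hd hdn hn e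
  have := (hD f hf.1).1 (hvan f hf)
  rw [hrk] at this
  exact lt_irrefl _ this

/-- **Certificate form.**  No `D` in the coefficient variables that is NONZERO at every degree-`≤ n`
polynomial of full block rank (the soundness property of an LST-type certificate for the given
word datum) vanishes on `SmallCircuits ℂ n 5`, `n ≥ 4`. [cite: ForbesShpilkaVolk2018, Def. 1] -/
theorem no_pdRankCertificate_smallCircuits {n : ℕ} (h4 : 4 ≤ n) (hd : 1 ≤ d) (hdn : d ≤ n)
    (hn : ∀ t ≤ d, 2 ^ overLen k pos t ≤ n) (e : (Σ i : Fin d, BlockVar k pos i) ↪ Fin n) :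
    ¬ ∃ D : MvPolynomial (degLEMonomials n) ℂ,
      (∀ g : MvPolynomial (Fin n) ℂ, g.totalDegree ≤ n →
        pdRank ℂ (posBlocks pos) (negBlocks pos) (killCompl e.injective g) =
          2 ^ min (streamLen k pos true d) (streamLen k pos false d) →
        eval (coeffVector (degLEMonomials n) g) D ≠ 0) ∧
      ∀ f ∈ SmallCircuits ℂ n 5, eval (coeffVector (degLEMonomials n) f) D = 0 := by
  rintro ⟨D, hsound, hvan⟩
  obtain ⟨f, hf, hrk⟩ := exists_fullPdRank_smallCircuits k pos h4 hd hdn hn e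
  exact hsound f hf.1 hrk (hvan f hf)

end ProductDepthWall

end Summit.ValiantsHypothesis.ValiantsHypothesis.Theorems.BarrierLeverDefinableEquations
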